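import Mathlib
import HarnessLib

/-!
# The simplest quartic fields `ℚ(α)`, `α⁴ − aα³ − 6α² + aα + 1 = 0` [LettlPetho1995, §2]

Topic `NumberTheory/DiophantineGeometry`; companion of the named fact `SimplestQuarticThueSolutions`
(`SimplestQuarticThue.lean`, [ChenVoutier1997, Thm 3] = [LettlPetho1995, Thm 1]).  Chen–Voutier prove
the theorem only for `t ≥ 128` (formalised in `SimplestQuarticThueMeasure.lean`) and refer to
G. Lettl, A. Pethő, *Complete solution of a family of quartic Thue equations*, Abh. Math. Sem. Univ.
Hamburg **65** (1995) 365–383 [LettlPetho1995] for `1 ≤ t ≤ 127`.  This file formalises the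
algebraic set-up of [LettlPetho1995, §2] used by that proof (Baker's method):

* `quarticPoly a = X⁴ − aX³ − 6X² + aX + 1 ∈ ℤ[X]` is irreducible for `a ∉ {0, ±3}`
  (`irreducible_quarticPoly`; "For all other values of `a`, `F_a` is irreducible", p. 366);
* if `α > 1` is a real root then `x ↦ (x − 1)/(x + 1)` permutes the four real roots
  `α > τα > 0 > τ²α > −1 > τ³α` ("the rational map `x ↦ (x−1)/(x+1)` permutes the roots of `f_a`",
  p. 367, and (6): `τ(α) = 1/β`, `τ(β) = −α`, `τ²(α) = −1/α`, `τ²(β) = −1/β` with `β = (α+1)/(α−1)`);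
* the number field `K = ℚ(α) ⊂ ℝ` has degree `4`, the automorphism `τ` (`tau`), the four real
  embeddings `σⱼ = val ∘ τʲ`, and for `z ∈ 𝓞 = ℤ[α, β]` the norm `∏ⱼ σⱼ(z)` is a rational integer
  (`prod_conj_mem_range_intCast`);
* the order `𝓞 := ℤ[α, β]` is `τ`-stable (Lemma 2) and `8·𝓞 ⊆ ℤ[α]`
  (`2β = α³ + (1−a)α² − (a+5)α − 3`).

Everything here is PROVED; no new definitions of mathematical content beyond abbreviations.

## References

* G. Lettl, A. Pethő, Abh. Math. Sem. Univ. Hamburg 65 (1995) 365–383, §2 (pp. 366–370).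
  [LettlPetho1995]
* Chen Jian Hua, P. Voutier, J. Number Theory 62 (1997) 71–99, §3. [ChenVoutier1997]
-/

noncomputable section

open Polynomial IntermediateField

namespace Literature.NumberTheory.DiophantineGeometry

namespace SimplestQuarticField

/-! ## The polynomial `f_a = X⁴ − aX³ − 6X² + aX + 1` and its irreducibility -/

/-- `f_a(X) = X⁴ − aX³ − 6X² + aX + 1 ∈ ℤ[X]` [cite: LettlPetho1995, (4)]. -/
def quarticPoly (a : ℤ) : ℤ[X] := X ^ 4 - C a * X ^ 3 - C 6 * X ^ 2 + C a * X + 1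

variable {a : ℤ}

/-- `quarticPoly_monic` (auxiliary). [folklore] -/
theorem quarticPoly_monic (a : ℤ) : (quarticPoly a).Monic := by
  unfold quarticPoly
  monicity!

/-- `quarticPoly_natDegree` (auxiliary). [folklore] -/
theorem quarticPoly_natDegree (a : ℤ) : (quarticPoly a).natDegree = 4 := by
  unfold quarticPoly
  compute_degree!

/-- `eval_quarticPoly` (auxiliary). [folklore] -/
@[simp] theorem eval_quarticPoly (a x : ℤ) :
    (quarticPoly a).eval x = x ^ 4 - a * x ^ 3 - 6 * x ^ 2 + a * x + 1 := by
  simp [quarticPoly]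

/-- No monic linear factor: an integer root `r` of `f_a` divides `1`, but `f_a(±1) = −4`.
[cite: LettlPetho1995, p. 366] -/
theorem quarticPoly_eval_ne_zero (a r : ℤ) : (quarticPoly a).eval r ≠ 0 := by
  rw [eval_quarticPoly]
  intro h
  have hdvd : r ∣ 1 := ⟨-(r ^ 3 - a * r ^ 2 - 6 * r + a), by linear_combination h⟩
  rcases Int.isUnit_iff.mp (isUnit_of_dvd_one hdvd) with rfl | rfl <;> omega

/-- A monic factorisation into two quadratics forces `a ∈ {0, ±3}`.
[cite: LettlPetho1995, p. 366 ("If `a ∈ {0, ±3}`, `F_a` factors into two quadratic forms")] -/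
theorem ne_mul_quadratic (ha0 : a ≠ 0) (ha3 : a ≠ 3) (ha3' : a ≠ -3) (b c d e : ℤ) :
    quarticPoly a ≠ (X ^ 2 + C b * X + C c) * (X ^ 2 + C d * X + C e) := by
  intro h
  have h0 := congrArg (eval 0) h
  have h1 := congrArg (eval 1) h
  have h1' := congrArg (eval (-1)) h
  have h2 := congrArg (eval 2) h
  simp only [eval_quarticPoly, eval_mul, eval_add, eval_pow, eval_X, eval_C] at h0 h1 h1' h2
  norm_num at h0 h1 h1' h2
  -- `c e = 1`
  have hce : c = 1 ∧ e = 1 ∨ c = -1 ∧ e = -1 := by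
    rcases Int.eq_one_or_neg_one_of_mul_eq_one h0.symm with rfl | rfl
    · left; constructor <;> linarith
    · right; constructor <;> linarith
  rcases hce with ⟨rfl, rfl⟩ | ⟨rfl, rfl⟩
  · -- `(2+b)(2+d) = -4 = (2-b)(2-d)` gives `b² = 8`
    have hbd : d = -b := by nlinarith
    subst hbd
    have hb : b ^ 2 = 8 := by nlinarith
    have hb3 : b < 3 := by nlinarith
    have hb3' : -3 < b := by nlinarith
    interval_cases b <;> omega
  · -- `b d = -4`, `b + d = -a`
    have hbd : b * d = -4 := by nlinarith
    have hsum : b + d = -a := by nlinarith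
    have hb : b ≠ 0 := by rintro rfl; simp at hbd
    have hb4 : -4 ≤ b ∧ b ≤ 4 := by
      have : |b| ≤ 4 := by
        have h1 : 1 ≤ |d| := Int.one_le_abs (by rintro rfl; simp at hbd)
        have h2 : |b| * |d| = 4 := by rw [← abs_mul, hbd]; norm_num
        nlinarith [abs_nonneg b]
      exact abs_le.mp this
    obtain ⟨hb1, hb2⟩ := hb4
    interval_cases b <;> omega

/-- **`f_a` is irreducible over `ℤ` for `a ∉ {0, ±3}`.** [cite: LettlPetho1995, p. 366] -/
theorem irreducible_quarticPoly (ha0 : a ≠ 0) (ha3 : a ≠ 3) (ha3' : a ≠ -3) :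
    Irreducible (quarticPoly a) := by
  have hmon := quarticPoly_monic a
  have hdeg := quarticPoly_natDegree a
  refine hmon.irreducible_iff_natDegree'.mpr ⟨?_, ?_⟩
  · intro h
    have := congrArg natDegree h
    rw [hdeg, natDegree_one] at this
    exact absurd this (by norm_num)
  intro g h hg hh hfac
  rw [hdeg]
  simp only [Nat.reduceDiv, Finset.mem_Ioc, not_and, not_le]
  intro h0
  -- `natDegree g + natDegree h = 4`
  have hsum : g.natDegree + h.natDegree = 4 := by
    have := congrArg natDegree hfac
    rwa [hg.natDegree_mul hh, hdeg] at this
  by_contra hle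
  push Not at hle
  interval_cases hhd : h.natDegree
  · -- a monic linear factor gives an integer root
    have heq : h = X + C (h.coeff 0) := hh.eq_X_add_C hhd
    have hroot : (quarticPoly a).eval (-h.coeff 0) = 0 := by
      rw [← hfac, eval_mul, heq]
      simp
    exact quarticPoly_eval_ne_zero a _ hroot
  · -- two monic quadratics
    have hgd : g.natDegree = 2 := by omega
    have heg : g = X ^ 2 + C (g.coeff 1) * X + C (g.coeff 0) := by
      conv_lhs => rw [hg.as_sum, hgd]
      simp [Finset.sum_range_succ]
      ring
    have heh : h = X ^ 2 + C (h.coeff 1) * X + C (h.coeff 0) := by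
      conv_lhs => rw [hh.as_sum, hhd]
      simp [Finset.sum_range_succ]
      ring
    exact ne_mul_quadratic ha0 ha3 ha3' (g.coeff 1) (g.coeff 0) (h.coeff 1) (h.coeff 0)
      (by rw [← hfac, ← heg, ← heh])

/-- Irreducibility over `ℚ` (Gauss). [cite: LettlPetho1995, p. 366] -/
theorem irreducible_quarticPoly_map (ha0 : a ≠ 0) (ha3 : a ≠ 3) (ha3' : a ≠ -3) :
    Irreducible ((quarticPoly a).map (Int.castRingHom ℚ)) :=
  ((quarticPoly_monic a).irreducible_iff_irreducible_map_fraction_map).mp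
    (irreducible_quarticPoly ha0 ha3 ha3')

/-! ## The four real roots `α, τα, τ²α, τ³α` [LettlPetho1995, §2 (5)–(6)] -/

/-- `f_a` as a real function. [cite: LettlPetho1995, (4)] -/
def fR (a : ℤ) (x : ℝ) : ℝ := x ^ 4 - a * x ^ 3 - 6 * x ^ 2 + a * x + 1

/-- The Möbius map `x ↦ (x − 1)/(x + 1)` permuting the roots of `f_a`. [cite: LettlPetho1995, p. 367] -/
def moeb (x : ℝ) : ℝ := (x - 1) / (x + 1)

/-- The orbit `α, τα, τ²α, …` of `α` under the Möbius map. [cite: LettlPetho1995, (6)] -/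
def conj (α : ℝ) : ℕ → ℝ
  | 0 => α
  | n + 1 => moeb (conj α n)

/-- `conj_zero` (auxiliary). [folklore] -/
@[simp] theorem conj_zero (α : ℝ) : conj α 0 = α := rfl

/-- `conj_succ` (auxiliary). [folklore] -/
theorem conj_succ (α : ℝ) (n : ℕ) : conj α (n + 1) = moeb (conj α n) := rfl

/-- `aeval_quarticPoly_real` (auxiliary). [folklore] -/
theorem aeval_quarticPoly_real (a : ℤ) (x : ℝ) : aeval x (quarticPoly a) = fR a x := by
  simp only [quarticPoly, fR, map_add, map_sub, map_mul, map_pow, aeval_X, aeval_C, map_one]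
  simp

/-- `eval_map_quarticPoly_real` (auxiliary). [folklore] -/
theorem eval_map_quarticPoly_real (a : ℤ) (x : ℝ) :
    ((quarticPoly a).map (Int.castRingHom ℝ)).eval x = fR a x := by
  rw [eval_map]
  simp only [quarticPoly, fR, eval₂_add, eval₂_sub, eval₂_mul, eval₂_X_pow, eval₂_C, eval₂_X,
    eval₂_one]
  simp

/-- `(x+1)⁴ f_a((x−1)/(x+1)) = −4 f_a(x)`. [cite: LettlPetho1995, p. 367] -/
theorem fR_moeb {x : ℝ} (hx : x + 1 ≠ 0) (a : ℤ) : fR a (moeb x) = -4 * fR a x / (x + 1) ^ 4 := by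
  unfold fR moeb
  field_simp
  ring

section Roots

variable {a : ℤ} {α : ℝ}

/-- `τα = (α − 1)/(α + 1)`. [cite: LettlPetho1995, (6)] -/
theorem conj_one (α : ℝ) : conj α 1 = (α - 1) / (α + 1) := rfl

/-- `τ²α = −1/α`. [cite: LettlPetho1995, (6)] -/
theorem conj_two (hα : 1 < α) : conj α 2 = -1 / α := by
  rw [conj_succ, conj_one, moeb]
  have h1 : α + 1 ≠ 0 := by positivity
  have h0 : α ≠ 0 := by positivity
  have e1 : (α - 1) / (α + 1) - 1 = -2 / (α + 1) := by field_simp; ring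
  have e2 : (α - 1) / (α + 1) + 1 = 2 * α / (α + 1) := by field_simp; ring
  rw [e1, e2, div_div_div_cancel_right₀ h1, div_eq_div_iff (by positivity) h0]
  ring

/-- `τ³α = −(α + 1)/(α − 1)`. [cite: LettlPetho1995, (6)] -/
theorem conj_three (hα : 1 < α) : conj α 3 = -(α + 1) / (α - 1) := by
  rw [conj_succ, conj_two hα, moeb]
  have h0 : α ≠ 0 := by positivity
  have h3 : α - 1 ≠ 0 := sub_ne_zero.mpr hα.ne'
  have e1 : -1 / α - 1 = -(α + 1) / α := by field_simp; ring
  have e2 : -1 / α + 1 = (α - 1) / α := by field_simp; ring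
  rw [e1, e2, div_div_div_cancel_right₀ h0]

/-- `τ⁴α = α`. [cite: LettlPetho1995, §2] -/
theorem conj_four (hα : 1 < α) : conj α 4 = α := by
  rw [conj_succ, conj_three hα, moeb]
  have h3 : α - 1 ≠ 0 := sub_ne_zero.mpr hα.ne'
  have e1 : -(α + 1) / (α - 1) - 1 = -2 * α / (α - 1) := by field_simp; ring
  have e2 : -(α + 1) / (α - 1) + 1 = -2 / (α - 1) := by field_simp; ring
  rw [e1, e2, div_div_div_cancel_right₀ h3, div_eq_iff (by norm_num)]
  ring

/-- `conj_add_four` (auxiliary). [folklore] -/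
theorem conj_add_four (hα : 1 < α) (n : ℕ) : conj α (n + 4) = conj α n := by
  induction n with
  | zero => simpa using conj_four hα
  | succ n ih => rw [show n + 1 + 4 = (n + 4) + 1 by ring, conj_succ, ih, conj_succ]

/-- `conj_mod_four` (auxiliary). [folklore] -/
theorem conj_mod_four (hα : 1 < α) (n : ℕ) : conj α n = conj α (n % 4) := by
  conv_lhs => rw [← Nat.mod_add_div n 4]
  generalize n / 4 = q
  induction q with
  | zero => simp
  | succ q ih => rw [show n % 4 + 4 * (q + 1) = (n % 4 + 4 * q) + 4 by ring, conj_add_four hα, ih]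

/-- `0 < τα < 1`. [cite: LettlPetho1995, (5.b)] -/
theorem conj_one_bounds (hα : 1 < α) : 0 < conj α 1 ∧ conj α 1 < 1 := by
  rw [conj_one]
  have h1 : 0 < α + 1 := by positivity
  constructor
  · exact div_pos (by linarith) h1
  · rw [div_lt_one h1]; linarith

/-- `−1 < τ²α < 0`. [cite: LettlPetho1995, (5.c)] -/
theorem conj_two_bounds (hα : 1 < α) : -1 < conj α 2 ∧ conj α 2 < 0 := by
  rw [conj_two hα]
  have h0 : 0 < α := by positivity
  constructor
  · rw [neg_div, neg_lt_neg_iff, div_lt_one h0]; linarith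
  · rw [neg_div, neg_lt_zero]; positivity

/-- `τ³α < −1`. [cite: LettlPetho1995, (5.d)] -/
theorem conj_three_lt (hα : 1 < α) : conj α 3 < -1 := by
  rw [conj_three hα, neg_div, neg_lt_neg_iff, one_lt_div (sub_pos.mpr hα)]
  linarith

/-- The four conjugates are pairwise distinct. [cite: LettlPetho1995, §2] -/
theorem conj_injOn (hα : 1 < α) : Set.InjOn (conj α) ↑(Finset.range 4) := by
  have h1 := conj_one_bounds hα
  have h2 := conj_two_bounds hα
  have h3 := conj_three_lt hα
  intro i hi j hj hij
  simp only [Finset.coe_range, Set.mem_Iio] at hi hj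
  have key : ∀ i < 4, ∀ j < 4, conj α i = conj α j → i ≤ j := by
    intro i hi j hj hij
    interval_cases i <;> interval_cases j <;> simp_all <;> linarith
  exact le_antisymm (key i hi j hj hij) (key j hj i hi hij.symm)

/-- `conj_ne_neg_one` (auxiliary). [folklore] -/
theorem conj_ne_neg_one (hα : 1 < α) (n : ℕ) : conj α n + 1 ≠ 0 := by
  rw [conj_mod_four hα]
  have h1 := conj_one_bounds hα
  have h2 := conj_two_bounds hα
  have h3 := conj_three_lt hα
  have : n % 4 < 4 := Nat.mod_lt _ (by norm_num)
  interval_cases (n % 4) <;> simp_all <;> linarith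

/-- Every `τʲα` is a root of `f_a`. [cite: LettlPetho1995, p. 367] -/
theorem fR_conj (hα : 1 < α) (hf : fR a α = 0) (n : ℕ) : fR a (conj α n) = 0 := by
  induction n with
  | zero => simpa using hf
  | succ n ih => rw [conj_succ, fR_moeb (conj_ne_neg_one hα n), ih]; simp

/-- **`f_a(X) = ∏ⱼ (X − τʲα)` over `ℝ`.** [cite: LettlPetho1995, §3 ("`F_a(x,y) = ∏(x − αᵢy)`")] -/
theorem map_quarticPoly_eq_prod (hα : 1 < α) (hf : fR a α = 0) :
    (quarticPoly a).map (Int.castRingHom ℝ) = ∏ j ∈ Finset.range 4, (X - C (conj α j)) := by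
  set p := (quarticPoly a).map (Int.castRingHom ℝ) with hp
  set q := ∏ j ∈ Finset.range 4, (X - C (conj α j)) with hq
  have hpm : p.Monic := (quarticPoly_monic a).map _
  have hpd : p.natDegree = 4 := by rw [hp, natDegree_map_eq_of_injective (Int.cast_injective), quarticPoly_natDegree]
  have hqm : q.Monic := monic_prod_of_monic _ _ fun j _ => monic_X_sub_C _
  have hqd : q.natDegree = 4 := by
    rw [hq, natDegree_prod_of_monic _ _ fun j _ => monic_X_sub_C _]
    simp
  -- `p - q` has degree `< 4` and vanishes at the four distinct conjugates
  by_contra hne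
  have hne' : p - q ≠ 0 := sub_ne_zero.mpr hne
  have hp0 : p ≠ 0 := hpm.ne_zero
  have hdeg : (p - q).natDegree < 4 := by
    have h1 : (p - q).degree < p.degree :=
      degree_sub_lt (by rw [degree_eq_natDegree hp0, degree_eq_natDegree hqm.ne_zero, hpd, hqd]) hp0
        (by rw [hpm.leadingCoeff, hqm.leadingCoeff])
    rw [degree_eq_natDegree hp0, hpd] at h1
    exact (natDegree_lt_iff_degree_lt hne').mpr h1
  refine hne' (eq_zero_of_natDegree_lt_card_of_eval_eq_zero' (p - q)
    (Finset.image (conj α) (Finset.range 4)) ?_ ?_)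
  · intro x hx
    obtain ⟨j, hj, rfl⟩ := Finset.mem_image.mp hx
    rw [eval_sub, hp, eval_map_quarticPoly_real, fR_conj hα hf, hq, eval_prod, zero_sub, neg_eq_zero]
    exact Finset.prod_eq_zero hj (by simp)
  · rwa [Finset.card_image_of_injOn (conj_injOn hα), Finset.card_range]

/-- `f_a(x) = ∏ⱼ (x − τʲα)` for real `x`. [cite: LettlPetho1995, §3] -/
theorem fR_eq_prod (hα : 1 < α) (hf : fR a α = 0) (x : ℝ) :
    fR a x = ∏ j ∈ Finset.range 4, (x - conj α j) := by
  rw [← eval_map_quarticPoly_real, map_quarticPoly_eq_prod hα hf, eval_prod]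
  simp

/-- A real root of `f_a` is one of the four conjugates. [cite: LettlPetho1995, §2] -/
theorem eq_conj_of_fR_eq_zero (hα : 1 < α) (hf : fR a α = 0) {x : ℝ} (hx : fR a x = 0) :
    ∃ j < 4, x = conj α j := by
  rw [fR_eq_prod hα hf, Finset.prod_eq_zero_iff] at hx
  obtain ⟨j, hj, h⟩ := hx
  exact ⟨j, Finset.mem_range.mp hj, sub_eq_zero.mp h⟩

end Roots

/-! ## The number field `K = ℚ(α) ⊂ ℝ`, the automorphism `τ`, the four real embeddings -/

/-- `f_a(β) = 0` for `β = (α+1)/(α−1)` and the parameter `−a`: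
`(α−1)⁴ f_{−a}((α+1)/(α−1)) = −4 f_a(α)`. [cite: LettlPetho1995, Lemma 1 (iv), (6)] -/
theorem fR_neg_beta {α : ℝ} (hα : α - 1 ≠ 0) (a : ℤ) :
    fR (-a) ((α + 1) / (α - 1)) = -4 * fR a α / (α - 1) ^ 4 := by
  unfold fR
  push_cast
  field_simp
  ring

/-- Standing hypotheses of [LettlPetho1995, §2]: `a ∉ {0, ±3}` and `α > 1` is a root of `f_a`
(then `α` is the largest root, loc. cit. "`α = α₁ > 1`"). [cite: LettlPetho1995, §2] -/
structure SQData (a : ℤ) (α : ℝ) : Prop where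
  ne_zero : a ≠ 0
  ne_three : a ≠ 3
  ne_neg_three : a ≠ -3
  one_lt : 1 < α
  root : fR a α = 0

section Field

variable {a : ℤ} {α : ℝ} (h : SQData a α)
include h

/-- `SQData.sub_one_ne` (auxiliary). [folklore] -/
theorem SQData.sub_one_ne : α - 1 ≠ 0 := sub_ne_zero.mpr h.one_lt.ne'

/-- `SQData.add_one_ne` (auxiliary). [folklore] -/
theorem SQData.add_one_ne : α + 1 ≠ 0 := by have := (one_pos.trans h.one_lt); positivity

/-- `α` is an algebraic integer. [cite: LettlPetho1995, §2] -/
theorem SQData.isIntegral_int : IsIntegral ℤ α :=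
  ⟨quarticPoly a, quarticPoly_monic a, by rw [← aeval_def, aeval_quarticPoly_real, h.root]⟩

/-- `SQData.isIntegral` (auxiliary). [folklore] -/
theorem SQData.isIntegral : IsIntegral ℚ α := h.isIntegral_int.tower_top

/-- The minimal polynomial of `α` over `ℚ` is `f_a`. [cite: LettlPetho1995, §2] -/
theorem SQData.minpoly_eq : minpoly ℚ α = (quarticPoly a).map (algebraMap ℤ ℚ) := by
  symm
  refine minpoly.eq_of_irreducible_of_monic ?_ ?_ ((quarticPoly_monic a).map _)
  · rw [algebraMap_int_eq]
    exact irreducible_quarticPoly_map h.ne_zero h.ne_three h.ne_neg_three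
  · rw [aeval_map_algebraMap, aeval_quarticPoly_real, h.root]

/-- `SQData.natDegree_minpoly` (auxiliary). [folklore] -/
theorem SQData.natDegree_minpoly : (minpoly ℚ α).natDegree = 4 := by
  rw [h.minpoly_eq, natDegree_map_eq_of_injective (algebraMap ℤ ℚ).injective_int, quarticPoly_natDegree]

/-- **`[ℚ(α) : ℚ] = 4`.** [cite: LettlPetho1995, §2 ("`K := ℚ(α)` is a real quartic number field")] -/
theorem SQData.finrank : Module.finrank ℚ ℚ⟮α⟯ = 4 := by
  rw [adjoin.finrank h.isIntegral, h.natDegree_minpoly]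

/-- `SQData.finiteDimensional_inst` (auxiliary). [folklore] -/
instance SQData.finiteDimensional_inst (α : ℝ) [Fact (IsIntegral ℚ α)] : FiniteDimensional ℚ ℚ⟮α⟯ :=
  adjoin.finiteDimensional Fact.out

omit h in
/-- The generator `α ∈ ℚ(α)`. [folklore] -/
theorem coe_gen : ((AdjoinSimple.gen ℚ α : ℚ⟮α⟯) : ℝ) = α := rfl

/-- `α⁴ = aα³ + 6α² − aα − 1` in `ℚ(α)`. [cite: LettlPetho1995, (4)] -/
theorem SQData.gen_pow_four :
    (AdjoinSimple.gen ℚ α : ℚ⟮α⟯) ^ 4 =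
      a * AdjoinSimple.gen ℚ α ^ 3 + 6 * AdjoinSimple.gen ℚ α ^ 2 - a * AdjoinSimple.gen ℚ α - 1 := by
  apply (algebraMap ℚ⟮α⟯ ℝ).injective
  simp only [map_pow, map_sub, map_add, map_mul, AdjoinSimple.algebraMap_gen, map_intCast, map_ofNat,
    map_one]
  have := h.root
  unfold fR at this
  linarith

/-- `τα = (α − 1)/(α + 1)` as an element of `ℚ(α)`. [cite: LettlPetho1995, (6)] -/
def moebK (α : ℝ) : ℚ⟮α⟯ := (AdjoinSimple.gen ℚ α - 1) / (AdjoinSimple.gen ℚ α + 1)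

omit h in
/-- `coe_moebK` (auxiliary). [folklore] -/
theorem coe_moebK (α : ℝ) : (moebK α : ℝ) = moeb α := by
  simp [moebK, moeb]

/-- `SQData.gen_add_one_ne` (auxiliary). [folklore] -/
theorem SQData.gen_add_one_ne : (AdjoinSimple.gen ℚ α : ℚ⟮α⟯) + 1 ≠ 0 := by
  intro h0
  have := congrArg (algebraMap ℚ⟮α⟯ ℝ) h0
  rw [map_add, map_one, map_zero, AdjoinSimple.algebraMap_gen] at this
  exact h.add_one_ne this

/-- `SQData.gen_sub_one_ne` (auxiliary). [folklore] -/
theorem SQData.gen_sub_one_ne : (AdjoinSimple.gen ℚ α : ℚ⟮α⟯) - 1 ≠ 0 := by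
  intro h0
  have := congrArg (algebraMap ℚ⟮α⟯ ℝ) h0
  rw [map_sub, map_one, map_zero, AdjoinSimple.algebraMap_gen] at this
  exact h.sub_one_ne this

/-- `τα` is a root of the minimal polynomial of `α`. [cite: LettlPetho1995, p. 367] -/
theorem SQData.moebK_mem_aroots : moebK α ∈ (minpoly ℚ α).aroots ℚ⟮α⟯ := by
  rw [mem_aroots]
  refine ⟨minpoly.ne_zero h.isIntegral, ?_⟩
  apply (algebraMap ℚ⟮α⟯ ℝ).injective
  rw [← aeval_algebraMap_apply, map_zero, h.minpoly_eq, aeval_map_algebraMap]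
  change aeval (moebK α : ℝ) (quarticPoly a) = 0
  rw [coe_moebK, aeval_quarticPoly_real]
  have := fR_conj h.one_lt h.root 1
  rwa [conj_succ, conj_zero] at this

/-- **The automorphism `τ : α ↦ (α−1)/(α+1)` of `K = ℚ(α)`.** [cite: LettlPetho1995, §2] -/
def SQData.tau : ℚ⟮α⟯ →ₐ[ℚ] ℚ⟮α⟯ :=
  (algHomAdjoinIntegralEquiv ℚ h.isIntegral).symm ⟨moebK α, h.moebK_mem_aroots⟩

/-- `SQData.tau_gen` (auxiliary). [folklore] -/
theorem SQData.tau_gen : h.tau (AdjoinSimple.gen ℚ α) = moebK α :=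
  algHomAdjoinIntegralEquiv_symm_apply_gen ℚ h.isIntegral ⟨moebK α, h.moebK_mem_aroots⟩

/-- The real embeddings `σⱼ = (K ⊂ ℝ) ∘ τʲ`. [cite: LettlPetho1995, §2] -/
def SQData.emb (n : ℕ) : ℚ⟮α⟯ →ₐ[ℚ] ℝ := (IntermediateField.val ℚ⟮α⟯).comp (h.tau ^ n)

/-- `SQData.emb_apply` (auxiliary). [folklore] -/
theorem SQData.emb_apply (n : ℕ) (z : ℚ⟮α⟯) : h.emb n z = (((h.tau ^ n) z : ℚ⟮α⟯) : ℝ) := rfl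

/-- `SQData.emb_zero_apply` (auxiliary). [folklore] -/
@[simp] theorem SQData.emb_zero_apply (z : ℚ⟮α⟯) : h.emb 0 z = (z : ℝ) := by
  simp [SQData.emb_apply]

/-- `σⱼ(α) = τʲα`. [cite: LettlPetho1995, (6)] -/
theorem SQData.emb_gen (n : ℕ) : h.emb n (AdjoinSimple.gen ℚ α) = conj α n := by
  induction n with
  | zero => simp [SQData.emb_apply]
  | succ n ih =>
    rw [SQData.emb_apply] at ih ⊢
    rw [pow_succ, AlgHom.mul_apply, h.tau_gen, moebK, map_div₀, map_sub, map_add, map_one, conj_succ,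
      moeb]
    push_cast
    rw [ih]

/-- `SQData.emb_add_four` (auxiliary). [folklore] -/
theorem SQData.emb_add_four (n : ℕ) : h.emb (n + 4) = h.emb n := by
  apply adjoin_algHom_ext
  intro x hx
  rw [Set.mem_singleton_iff] at hx
  subst hx
  change h.emb (n + 4) (AdjoinSimple.gen ℚ x) = h.emb n (AdjoinSimple.gen ℚ x)
  rw [h.emb_gen, h.emb_gen, conj_add_four h.one_lt]

/-- `τ⁴ = 1`. [cite: LettlPetho1995, §2 ("cyclic Galois group `G = ⟨τ⟩`")] -/
theorem SQData.tau_pow_four : h.tau ^ 4 = 1 := by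
  apply adjoin_algHom_ext
  intro x hx
  rw [Set.mem_singleton_iff] at hx
  subst hx
  apply (algebraMap ℚ⟮x⟯ ℝ).injective
  change h.emb 4 (AdjoinSimple.gen ℚ x) = ((AdjoinSimple.gen ℚ x : ℚ⟮x⟯) : ℝ)
  rw [h.emb_gen, conj_four h.one_lt, coe_gen]

/-- `SQData.tau_pow_add_four` (auxiliary). [folklore] -/
theorem SQData.tau_pow_add_four (n : ℕ) : h.tau ^ (n + 4) = h.tau ^ n := by
  rw [pow_add, h.tau_pow_four, mul_one]

/-- The embeddings `σ₀, …, σ₃` take pairwise distinct values at `α`. [folklore] -/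
theorem SQData.emb_injOn : Set.InjOn h.emb ↑(Finset.range 4) := by
  intro i hi j hj hij
  have := congrArg (fun φ : ℚ⟮α⟯ →ₐ[ℚ] ℝ => φ (AdjoinSimple.gen ℚ α)) hij
  simp only [h.emb_gen] at this
  exact conj_injOn h.one_lt hi hj this

/-- Every embedding `K → ℂ` is (the complexification of) some `σⱼ`: a complex root of `f_a` is one
of the four real conjugates. [cite: LettlPetho1995, §2] -/
theorem SQData.exists_emb_eq (σ : ℚ⟮α⟯ →ₐ[ℚ] ℂ) :
    ∃ n < 4, σ = (Complex.ofRealAm.restrictScalars ℚ).comp (h.emb n) := by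
  -- `σ(α)` is a complex root of `f_a = ∏ (X − τʲα)`
  have hroot : aeval (σ (AdjoinSimple.gen ℚ α)) (quarticPoly a) = 0 := by
    have h1 : aeval (σ (AdjoinSimple.gen ℚ α)) (minpoly ℚ α) = 0 := by
      have h0 := congrArg σ (aeval_gen_minpoly ℚ α)
      rw [map_zero] at h0
      convert h0 using 1
      exact aeval_algHom_apply σ _ _
    rwa [h.minpoly_eq, aeval_map_algebraMap] at h1
  have hprod : aeval (σ (AdjoinSimple.gen ℚ α)) (quarticPoly a) =
      ∏ j ∈ Finset.range 4, (σ (AdjoinSimple.gen ℚ α) - (conj α j : ℂ)) := by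
    have := congrArg (Polynomial.map (algebraMap ℝ ℂ)) (map_quarticPoly_eq_prod h.one_lt h.root)
    rw [Polynomial.map_map] at this
    rw [aeval_def, show algebraMap ℤ ℂ = (algebraMap ℝ ℂ).comp (Int.castRingHom ℝ) by ext; simp,
      ← eval_map, this, Polynomial.map_prod, eval_prod]
    simp
  rw [hprod, Finset.prod_eq_zero_iff] at hroot
  obtain ⟨n, hn, hzero⟩ := hroot
  refine ⟨n, Finset.mem_range.mp hn, ?_⟩
  apply adjoin_algHom_ext
  intro x hx
  rw [Set.mem_singleton_iff] at hx
  subst hx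
  change σ (AdjoinSimple.gen ℚ x) = (h.emb n (AdjoinSimple.gen ℚ x) : ℂ)
  rw [h.emb_gen]
  exact sub_eq_zero.mp hzero

/-- **The norm `∏ⱼ σⱼ(z)` of an algebraic integer `z ∈ K` is a rational integer**, non-zero for
`z ≠ 0`. [cite: LettlPetho1995, §3 ("`F_a(x,y)` is just the norm from `K` to `ℚ` of `x − α₁y`")] -/
theorem SQData.exists_norm_eq_int {z : ℚ⟮α⟯} (hz : IsIntegral ℤ z) :
    ∃ N : ℤ, (∏ n ∈ Finset.range 4, h.emb n z) = N ∧ (z ≠ 0 → N ≠ 0) := by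
  classical
  haveI : Fact (IsIntegral ℚ α) := ⟨h.isIntegral⟩
  obtain ⟨N, hN⟩ : ∃ N : ℤ, (N : ℚ) = Algebra.norm ℚ z := by
    have hI : IsIntegral ℤ (Algebra.norm ℚ z) := Algebra.isIntegral_norm ℚ hz
    obtain ⟨N, hN⟩ := (IsIntegrallyClosed.isIntegral_iff (R := ℤ) (K := ℚ)).mp hI
    exact ⟨N, by simpa using hN⟩
  refine ⟨N, ?_, fun hz0 h0 => ?_⟩
  · -- compare with the product over all embeddings into `ℂ`
    have hprod : ∏ σ : ℚ⟮α⟯ →ₐ[ℚ] ℂ, σ z = (N : ℂ) := by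
      rw [← Algebra.norm_eq_prod_embeddings ℚ ℂ z, ← hN]; simp
    -- reindex the embeddings by `Fin 4`
    let e : Fin 4 → (ℚ⟮α⟯ →ₐ[ℚ] ℂ) := fun n => (Complex.ofRealAm.restrictScalars ℚ).comp (h.emb n)
    have he : Function.Bijective e := by
      rw [Fintype.bijective_iff_injective_and_card, AlgHom.card ℚ ℚ⟮α⟯ ℂ, h.finrank, Fintype.card_fin]
      refine ⟨fun i j hij => ?_, rfl⟩
      have := congrArg (fun φ : ℚ⟮α⟯ →ₐ[ℚ] ℂ => φ (AdjoinSimple.gen ℚ α)) hij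
      simp only [e, AlgHom.coe_comp, Function.comp_apply, AlgHom.restrictScalars_apply,
        Complex.ofRealAm_coe, h.emb_gen, Complex.ofReal_inj] at this
      exact Fin.ext (conj_injOn h.one_lt (by simp) (by simp) this)
    have h2 : ∏ σ : ℚ⟮α⟯ →ₐ[ℚ] ℂ, σ z = ∏ n : Fin 4, e n z :=
      (Fintype.prod_bijective e he (fun n => e n z) (fun σ => σ z) fun _ => rfl).symm
    rw [h2] at hprod
    simp only [e, AlgHom.coe_comp, Function.comp_apply, AlgHom.restrictScalars_apply,
      Complex.ofRealAm_coe] at hprod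
    rw [Fin.prod_univ_eq_prod_range (fun n => (h.emb n z : ℂ)) 4, ← Complex.ofReal_prod] at hprod
    exact_mod_cast hprod
  · have : Algebra.norm ℚ z = 0 := by rw [← hN, h0]; simp
    exact (Algebra.norm_ne_zero_iff.mpr hz0) this

end Field

/-! ## The order `𝓞 = ℤ[α, β]`, `β = (α+1)/(α−1)` [LettlPetho1995, Lemma 2] -/

/-- `β = (α + 1)/(α − 1) = −τ³α` as an element of `ℚ(α)`. [cite: LettlPetho1995, p. 368] -/
def betaK (α : ℝ) : ℚ⟮α⟯ := (AdjoinSimple.gen ℚ α + 1) / (AdjoinSimple.gen ℚ α - 1)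

/-- The order `𝓞 = ℤ[α, β]`. [cite: LettlPetho1995, p. 368] -/
def ordr (α : ℝ) : Subalgebra ℤ ℚ⟮α⟯ := Algebra.adjoin ℤ {AdjoinSimple.gen ℚ α, betaK α}

/-- `ℤ[α] ⊆ 𝓞`. [cite: LettlPetho1995, Lemma 2] -/
def zAlpha (α : ℝ) : Subalgebra ℤ ℚ⟮α⟯ := Algebra.adjoin ℤ {AdjoinSimple.gen ℚ α}

/-- `coe_betaK` (auxiliary). [folklore] -/
theorem coe_betaK (α : ℝ) : (betaK α : ℝ) = (α + 1) / (α - 1) := by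
  simp [betaK]

/-- `gen_mem_ordr` (auxiliary). [folklore] -/
theorem gen_mem_ordr (α : ℝ) : AdjoinSimple.gen ℚ α ∈ ordr α :=
  Algebra.subset_adjoin (by simp)

/-- `betaK_mem_ordr` (auxiliary). [folklore] -/
theorem betaK_mem_ordr (α : ℝ) : betaK α ∈ ordr α :=
  Algebra.subset_adjoin (by simp)

/-- `gen_mem_zAlpha` (auxiliary). [folklore] -/
theorem gen_mem_zAlpha (α : ℝ) : AdjoinSimple.gen ℚ α ∈ zAlpha α :=
  Algebra.subset_adjoin (by simp)

/-- `zAlpha_le_ordr` (auxiliary). [folklore] -/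
theorem zAlpha_le_ordr (α : ℝ) : zAlpha α ≤ ordr α :=
  Algebra.adjoin_mono (by simp)

section Order

variable {a : ℤ} {α : ℝ} (h : SQData a α)
include h

/-- `1 < β`. [cite: LettlPetho1995, p. 368 ("`β := (α+1)/(α−1) = −τ³(α) > 1`")] -/
theorem SQData.one_lt_beta : 1 < (α + 1) / (α - 1) := by
  rw [one_lt_div (sub_pos.mpr h.one_lt)]; linarith

/-- `SQData.beta_pos` (auxiliary). [folklore] -/
theorem SQData.beta_pos : 0 < (α + 1) / (α - 1) := lt_trans one_pos h.one_lt_beta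

/-- `β` is a root of `f_{−a}`. [cite: LettlPetho1995, Lemma 1 (iv)] -/
theorem SQData.fR_neg_beta_eq_zero : fR (-a) ((α + 1) / (α - 1)) = 0 := by
  rw [fR_neg_beta h.sub_one_ne, h.root]; simp

/-- **The involution `a ↦ −a`, `α ↦ β`: the data for `(−a, β)`.** [cite: LettlPetho1995, Lemma 1 (iv)] -/
theorem SQData.neg : SQData (-a) ((α + 1) / (α - 1)) where
  ne_zero := by have := h.ne_zero; omega
  ne_three := by have := h.ne_neg_three; omega
  ne_neg_three := by have := h.ne_three; omega
  one_lt := h.one_lt_beta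
  root := h.fR_neg_beta_eq_zero

/-- `(β + 1)/(β − 1) = α`. [cite: LettlPetho1995, (6)] -/
theorem SQData.beta_beta : ((α + 1) / (α - 1) + 1) / ((α + 1) / (α - 1) - 1) = α := by
  have h3 := h.sub_one_ne
  have e1 : (α + 1) / (α - 1) + 1 = 2 * α / (α - 1) := by field_simp; ring
  have e2 : (α + 1) / (α - 1) - 1 = 2 / (α - 1) := by field_simp; ring
  rw [e1, e2, div_div_div_cancel_right₀ h3, mul_div_cancel_left₀ _ (by norm_num)]

/-- `SQData.betaK_ne_zero` (auxiliary). [folklore] -/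
theorem SQData.betaK_ne_zero : betaK α ≠ 0 := by
  intro h0
  have := congrArg (algebraMap ℚ⟮α⟯ ℝ) h0
  rw [map_zero] at this
  exact h.beta_pos.ne' (by rw [← coe_betaK]; exact this)

/-- `β⁴ = −aβ³ + 6β² + aβ − 1` in `ℚ(α)`. [cite: LettlPetho1995, Lemma 2] -/
theorem SQData.betaK_pow_four :
    betaK α ^ 4 = -a * betaK α ^ 3 + 6 * betaK α ^ 2 + a * betaK α - 1 := by
  apply (algebraMap ℚ⟮α⟯ ℝ).injective
  simp only [map_pow, map_sub, map_add, map_mul, map_neg, map_intCast, map_ofNat, map_one]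
  rw [show algebraMap ℚ⟮α⟯ ℝ (betaK α) = (α + 1) / (α - 1) from coe_betaK α]
  have := h.fR_neg_beta_eq_zero
  unfold fR at this
  push_cast at this
  linarith

/-- `2β = α³ + (1 − a)α² − (a + 5)α − 3`, so `ℤ[α] ⊆ 𝓞` has index `≤ 2` on `β`.
[cite: LettlPetho1995, Lemma 2 ("`(𝓞 : ℤ[α]) = 2`")] -/
theorem SQData.two_mul_betaK :
    2 * betaK α = AdjoinSimple.gen ℚ α ^ 3 + (1 - a) * AdjoinSimple.gen ℚ α ^ 2
      - (a + 5) * AdjoinSimple.gen ℚ α - 3 := by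
  have hg := h.gen_pow_four
  unfold betaK
  rw [mul_div_assoc', div_eq_iff h.gen_sub_one_ne]
  linear_combination -hg

/-- `8βʲ ∈ ℤ[α]` for all `j`. [cite: LettlPetho1995, Lemma 2] -/
theorem SQData.eight_mul_betaK_pow_mem (j : ℕ) : (8 : ℚ⟮α⟯) * betaK α ^ j ∈ zAlpha α := by
  induction j using Nat.strong_induction_on with
  | _ j ih =>
    have hg : AdjoinSimple.gen ℚ α ∈ zAlpha α := gen_mem_zAlpha α
    have hQ : 2 * betaK α ∈ zAlpha α := by
      rw [h.two_mul_betaK]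
      refine Subalgebra.sub_mem _ (Subalgebra.sub_mem _ (Subalgebra.add_mem _
        (Subalgebra.pow_mem _ hg 3) (Subalgebra.mul_mem _ ?_ (Subalgebra.pow_mem _ hg 2)))
        (Subalgebra.mul_mem _ ?_ hg)) ?_
      · exact Subalgebra.sub_mem _ (Subalgebra.one_mem _) (Subalgebra.intCast_mem _ a)
      · exact Subalgebra.add_mem _ (Subalgebra.intCast_mem _ a) (Subalgebra.natCast_mem _ 5)
      · exact Subalgebra.natCast_mem _ 3
    rcases lt_or_ge j 4 with hj | hj
    · interval_cases j
      · simp only [pow_zero, mul_one]; exact Subalgebra.natCast_mem (zAlpha α) 8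
      · have : (8 : ℚ⟮α⟯) * betaK α ^ 1 = 4 * (2 * betaK α) := by ring
        rw [this]; exact Subalgebra.mul_mem _ (Subalgebra.natCast_mem _ 4) hQ
      · have : (8 : ℚ⟮α⟯) * betaK α ^ 2 = 2 * (2 * betaK α) ^ 2 := by ring
        rw [this]; exact Subalgebra.mul_mem _ (Subalgebra.natCast_mem _ 2) (Subalgebra.pow_mem _ hQ 2)
      · have : (8 : ℚ⟮α⟯) * betaK α ^ 3 = (2 * betaK α) ^ 3 := by ring
        rw [this]; exact Subalgebra.pow_mem _ hQ 3
    · obtain ⟨k, rfl⟩ := Nat.exists_eq_add_of_le' hj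
      have e : (8 : ℚ⟮α⟯) * betaK α ^ (k + 4) =
          (-a) * (8 * betaK α ^ (k + 3)) + 6 * (8 * betaK α ^ (k + 2)) + a * (8 * betaK α ^ (k + 1))
            - 8 * betaK α ^ k := by
        rw [pow_add, h.betaK_pow_four]; ring
      rw [e]
      refine Subalgebra.sub_mem _ (Subalgebra.add_mem _ (Subalgebra.add_mem _
        (Subalgebra.mul_mem _ (Subalgebra.neg_mem _ (Subalgebra.intCast_mem _ a)) (ih _ (by omega)))
        (Subalgebra.mul_mem _ (Subalgebra.natCast_mem _ 6) (ih _ (by omega))))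
        (Subalgebra.mul_mem _ (Subalgebra.intCast_mem _ a) (ih _ (by omega)))) (ih _ (by omega))

/-- **`8·𝓞 ⊆ ℤ[α]`.** [cite: LettlPetho1995, Lemma 2 ("`(𝓞 : ℤ[α]) = 2`")] -/
theorem SQData.eight_mul_mem_zAlpha {z : ℚ⟮α⟯} (hz : z ∈ ordr α) : (8 : ℚ⟮α⟯) * z ∈ zAlpha α := by
  have hz' : z ∈ Subalgebra.toSubmodule (ordr α) := hz
  rw [ordr, Algebra.adjoin_eq_span] at hz'
  refine Submodule.span_induction ?_ ?_ ?_ ?_ hz'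
  · intro m hm
    obtain ⟨i, j, rfl⟩ := (Submonoid.mem_closure_pair _ _ _).mp hm
    rw [mul_left_comm]
    exact Subalgebra.mul_mem _ (Subalgebra.pow_mem _ (gen_mem_zAlpha α) i) (h.eight_mul_betaK_pow_mem j)
  · simp
  · intro x y _ _ hx hy
    rw [mul_add]; exact Subalgebra.add_mem _ hx hy
  · intro c x _ hx
    rw [mul_smul_comm]
    exact Subalgebra.smul_mem _ hx c

/-- Elements of `𝓞` are algebraic integers. [cite: LettlPetho1995, §2] -/
theorem SQData.isIntegral_of_mem_ordr {z : ℚ⟮α⟯} (hz : z ∈ ordr α) : IsIntegral ℤ z := by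
  have hgen : IsIntegral ℤ (AdjoinSimple.gen ℚ α : ℚ⟮α⟯) :=
    (isIntegral_algebraMap_iff (algebraMap ℚ⟮α⟯ ℝ).injective).mp
      (by rw [AdjoinSimple.algebraMap_gen]; exact h.isIntegral_int)
  have hbeta : IsIntegral ℤ (betaK α) := by
    refine (isIntegral_algebraMap_iff (algebraMap ℚ⟮α⟯ ℝ).injective).mp ?_
    rw [show algebraMap ℚ⟮α⟯ ℝ (betaK α) = (α + 1) / (α - 1) from coe_betaK α]
    exact h.neg.isIntegral_int
  have hle : ordr α ≤ integralClosure ℤ ℚ⟮α⟯ := by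
    refine Algebra.adjoin_le ?_
    rintro x (rfl | hx)
    · exact hgen
    · rw [Set.mem_singleton_iff] at hx
      subst hx
      exact hbeta
  exact hle hz

/-- `τβ = −α`. [cite: LettlPetho1995, (6)] -/
theorem SQData.tau_betaK : h.tau (betaK α) = -AdjoinSimple.gen ℚ α := by
  have h1 := h.gen_add_one_ne
  unfold betaK
  rw [map_div₀, map_add, map_sub, map_one, h.tau_gen, moebK]
  have e1 : (AdjoinSimple.gen ℚ α - 1) / (AdjoinSimple.gen ℚ α + 1) + 1 =
      2 * AdjoinSimple.gen ℚ α / (AdjoinSimple.gen ℚ α + 1) := by field_simp; ring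
  have e2 : (AdjoinSimple.gen ℚ α - 1) / (AdjoinSimple.gen ℚ α + 1) - 1 =
      -2 / (AdjoinSimple.gen ℚ α + 1) := by field_simp; ring
  rw [e1, e2, div_div_div_cancel_right₀ h1, div_eq_iff (by norm_num)]
  ring

/-- `τα = 1/β = −(β³ + aβ² − 6β − a)`. [cite: LettlPetho1995, (6), Lemma 2] -/
theorem SQData.tau_gen_eq : h.tau (AdjoinSimple.gen ℚ α) = -(betaK α ^ 3 + a * betaK α ^ 2 - 6 * betaK α - a) := by
  have hb := h.betaK_ne_zero
  have h4 := h.betaK_pow_four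
  -- `τα = 1/β`
  have hinv : h.tau (AdjoinSimple.gen ℚ α) = (betaK α)⁻¹ := by
    rw [h.tau_gen, moebK, betaK, inv_div]
  rw [hinv, inv_eq_iff_eq_inv, eq_comm, inv_eq_of_mul_eq_one_left]
  linear_combination -h4

/-- **`𝓞` is `τ`-stable** (Lemma 2: "The order `𝓞` is invariant under `G = Gal(K/ℚ)`").
[cite: LettlPetho1995, Lemma 2] -/
theorem SQData.tau_mem_ordr {z : ℚ⟮α⟯} (hz : z ∈ ordr α) : h.tau z ∈ ordr α := by
  refine Algebra.adjoin_induction (hx := hz) ?_ ?_ ?_ ?_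
  · rintro x (rfl | hx)
    · rw [h.tau_gen_eq]
      have hb := betaK_mem_ordr α
      refine Subalgebra.neg_mem _ (Subalgebra.sub_mem _ (Subalgebra.sub_mem _ (Subalgebra.add_mem _
        (Subalgebra.pow_mem _ hb 3) (Subalgebra.mul_mem _ (Subalgebra.intCast_mem _ a)
        (Subalgebra.pow_mem _ hb 2))) (Subalgebra.mul_mem _ (Subalgebra.natCast_mem _ 6) hb))
        (Subalgebra.intCast_mem _ a))
    · rw [Set.mem_singleton_iff] at hx
      subst hx
      rw [h.tau_betaK]
      exact Subalgebra.neg_mem _ (gen_mem_ordr α)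
  · intro r
    -- `τ` fixes `ℚ`, in particular the image of `ℤ`
    have e : (algebraMap ℤ ℚ⟮α⟯ r : ℚ⟮α⟯) = (r : ℚ⟮α⟯) := by simp
    rw [e, map_intCast]
    exact Subalgebra.intCast_mem _ r
  · intro x y _ _ hx hy
    rw [map_add]; exact Subalgebra.add_mem _ hx hy
  · intro x y _ _ hx hy
    rw [map_mul]; exact Subalgebra.mul_mem _ hx hy

/-- `SQData.tau_pow_mem_ordr` (auxiliary). [folklore] -/
theorem SQData.tau_pow_mem_ordr (n : ℕ) {z : ℚ⟮α⟯} (hz : z ∈ ordr α) : (h.tau ^ n) z ∈ ordr α := by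
  induction n with
  | zero => simpa using hz
  | succ n ih => rw [pow_succ', AlgHom.mul_apply]; exact h.tau_mem_ordr ih

/-- `σⱼ(β) = (τʲα + 1)/(τʲα − 1)`. [cite: LettlPetho1995, (6)] -/
theorem SQData.emb_betaK (n : ℕ) : h.emb n (betaK α) = (conj α n + 1) / (conj α n - 1) := by
  unfold betaK
  rw [map_div₀, map_add, map_sub, map_one, h.emb_gen]

/-- The conjugates of `β`: `σ₁(β) = −α`, `σ₂(β) = −1/β`, `σ₃(β) = 1/α`.
[cite: LettlPetho1995, (6)] -/
theorem SQData.emb_betaK_values :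
    h.emb 0 (betaK α) = (α + 1) / (α - 1) ∧ h.emb 1 (betaK α) = -α ∧
      h.emb 2 (betaK α) = -((α - 1) / (α + 1)) ∧ h.emb 3 (betaK α) = 1 / α := by
  have h0 := (one_pos.trans h.one_lt).ne'
  have h1 := h.add_one_ne
  have h3 := h.sub_one_ne
  refine ⟨by rw [h.emb_betaK, conj_zero], ?_, ?_, ?_⟩
  · rw [h.emb_betaK, conj_one]
    have e1 : (α - 1) / (α + 1) + 1 = 2 * α / (α + 1) := by field_simp; ring
    have e2 : (α - 1) / (α + 1) - 1 = -2 / (α + 1) := by field_simp; ring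
    rw [e1, e2, div_div_div_cancel_right₀ h1, div_eq_iff (by norm_num)]; ring
  · rw [h.emb_betaK, conj_two h.one_lt]
    have e1 : -1 / α + 1 = (α - 1) / α := by field_simp; ring
    have e2 : -1 / α - 1 = -(α + 1) / α := by field_simp; ring
    rw [e1, e2, div_div_div_cancel_right₀ h0, div_neg, neg_inj]
  · rw [h.emb_betaK, conj_three h.one_lt]
    have e1 : -(α + 1) / (α - 1) + 1 = -2 / (α - 1) := by field_simp; ring
    have e2 : -(α + 1) / (α - 1) - 1 = -2 * α / (α - 1) := by field_simp; ring
    rw [e1, e2, div_div_div_cancel_right₀ h3, div_eq_div_iff (by simpa using h0) h0]; ring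

/-- The conjugates of `α`: `σ₀α = α`, `σ₁α = (α−1)/(α+1) = 1/β`, `σ₂α = −1/α`, `σ₃α = −β`.
[cite: LettlPetho1995, (6)] -/
theorem SQData.emb_gen_values :
    h.emb 0 (AdjoinSimple.gen ℚ α) = α ∧ h.emb 1 (AdjoinSimple.gen ℚ α) = (α - 1) / (α + 1) ∧
      h.emb 2 (AdjoinSimple.gen ℚ α) = -1 / α ∧ h.emb 3 (AdjoinSimple.gen ℚ α) = -(α + 1) / (α - 1) := by
  refine ⟨by rw [h.emb_gen, conj_zero], by rw [h.emb_gen, conj_one], by rw [h.emb_gen, conj_two h.one_lt],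
    by rw [h.emb_gen, conj_three h.one_lt]⟩

/-- **The norm of `x − αy` is `F_a(x, y)`**: `∏ⱼ (x − σⱼ(α) y) = x⁴ − ax³y − 6x²y² + axy³ + y⁴`.
[cite: LettlPetho1995, §3 ("`F_a(x,y) = ∏ (x − αᵢy)` is just the norm from `K` to `ℚ` of `x − α₁y`")] -/
theorem SQData.prod_emb_sub_gen_mul (x y : ℚ) :
    ∏ n ∈ Finset.range 4, h.emb n ((x : ℚ⟮α⟯) - AdjoinSimple.gen ℚ α * y) =
      (x : ℝ) ^ 4 - a * x ^ 3 * y - 6 * x ^ 2 * y ^ 2 + a * x * y ^ 3 + y ^ 4 := by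
  have hprod := fR_eq_prod h.one_lt h.root
  simp only [map_sub, map_mul, map_ratCast, h.emb_gen]
  by_cases hy : y = 0
  · subst hy; simp
  · have hy' : (y : ℝ) ≠ 0 := by exact_mod_cast hy
    have key := hprod (x / y)
    unfold fR at key
    rw [Finset.prod_range_succ, Finset.prod_range_succ, Finset.prod_range_succ, Finset.prod_range_succ,
      Finset.prod_range_zero] at key ⊢
    field_simp at key
    linear_combination -key

end Order

end SimplestQuarticField

end Literature.NumberTheory.DiophantineGeometry
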